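import Summits.CriticalPhenomena.Ising3DConformalLimit.Theorems.FKParityRobustnessIndependentStrandsJoinEventuallyUpgrade
import Summits.CriticalPhenomena.Ising3DConformalLimit.Theorems.FKParityRobustnessIndependentStrandsJoinShapeDictionary
import Summits.CriticalPhenomena.Ising3DConformalLimit.Theorems.FKParityRobustnessJoinForcesU4
import HarnessLib

/-!
# Strategist census s3 — typed attempts for the crux `IndependentStrandsJoin` (stmt-CriticalPhenomena-14625)

Scratch of the independent strategy census (family `s`, seat s3).  Nothing here is a registered stub; the
file only certifies that the statements quoted in `STRATEGY-CENSUS-s3.md` elaborate and that the cheap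
implications claimed there are kernel-checked.

* §W  the two weakest replacements of the crux that still feed `closes` (from the summit downwards);
* §S  the strengthenings considered;
* §D  the typed splits considered (assembly proved) — NOT filed, see the census for why;
* §N  nothing typed (prose in the census).
-/

noncomputable section

open Literature.Probability.LatticeModels
open Summit.CriticalPhenomena.Ising3DConformalLimit.Theses.FKParityRobustness
open Summit.CriticalPhenomena.Ising3DConformalLimit.Cruxes.IndependentStrandsJoin.PinchToTetra
open Summit.CriticalPhenomena.Ising3DConformalLimit.Cruxes.ParityRobustMerging.PlaquetteXorSurgery (tetra tetra_inj)
open Summit.CriticalPhenomena.Ising3DConformalLimit.FKParityRobustnessFarMergingGivesU4 (farMergingGivesU4_proof)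
open Summit.CriticalPhenomena.Ising3DConformalLimit.FKParityRobustnessJoinForcesU4 (joinForcesU4_proof)

namespace Summit.CriticalPhenomena.Ising3DConformalLimit.Cruxes.IndependentStrandsJoin.S3

/-- The far-merging inequality of the critical lattice Ursell function at the dilation `L • x` of a lattice
shape `x`, with constant `c` and Aizenman's pairing `(01|23)`: `U₄^crit(L•x) ≤ -c·⟨σ_{Lx₀}σ_{Lx₁}⟩⟨σ_{Lx₂}σ_{Lx₃}⟩`. -/
def ShapeMergingAt (c : ℝ) (x : Fin 4 → Site 3) (L : ℕ) : Prop :=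
  criticalCorr 3 4 (fun i => (L : ℤ) • x i) -
      (criticalCorr 3 2 ![(L : ℤ) • x 0, (L : ℤ) • x 1] * criticalCorr 3 2 ![(L : ℤ) • x 2, (L : ℤ) • x 3] +
        criticalCorr 3 2 ![(L : ℤ) • x 0, (L : ℤ) • x 2] * criticalCorr 3 2 ![(L : ℤ) • x 1, (L : ℤ) • x 3] +
        criticalCorr 3 2 ![(L : ℤ) • x 0, (L : ℤ) • x 3] * criticalCorr 3 2 ![(L : ℤ) • x 1, (L : ℤ) • x 2]) ≤
    -(c * (criticalCorr 3 2 ![(L : ℤ) • x 0, (L : ℤ) • x 1] * criticalCorr 3 2 ![(L : ℤ) • x 2, (L : ℤ) • x 3]))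

/-! ## §W — weakest replacements of the crux that still feed `closes` -/

/-- **W1 (lattice form).** Far merging along the dilations of SOME injective lattice shape at INFINITELY MANY
scales — verbatim the antecedent of the landed glue `FarMergingGivesU4` (item 4471). -/
def SomeShapeMergingIO : Prop :=
  ∃ c : ℝ, 0 < c ∧ ∃ x : Fin 4 → Site 3, Function.Injective x ∧ ∀ L₀ : ℕ, ∃ L : ℕ, L₀ ≤ L ∧ ShapeMergingAt c x L

/-- Same, at ALL LARGE scales (the currency of the ∃-shape dictionary). -/
def SomeShapeMergingEventually : Prop :=
  ∃ c : ℝ, 0 < c ∧ ∃ x : Fin 4 → Site 3, Function.Injective x ∧ ∃ L₁ : ℕ, ∀ L : ℕ, L₁ ≤ L → ShapeMergingAt c x L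

/-- **W2 (continuum form).** Non-Gaussianity of every MÖBIUS-COVARIANT non-degenerate pointwise limit:
item 0636 `NonGaussianLimit` with the extra hypothesis `IsMoebiusCovariant Δ S` — the weakest statement that,
together with the route's residual `MoebiusLimit`, still gives the sub-problem. -/
def NonGaussianMoebiusLimit : Prop :=
  ∀ (ρ : ℝ → ℝ) (Δ : ℝ) (S : CorrFamily 3), (∀ δ ∈ Set.Ioc (0:ℝ) 1, 0 < ρ δ) → 0 < Δ →
    HasPointwiseScalingLimit (criticalCorr 3) ρ S → IsNondegenerateTwoPoint S → IsMoebiusCovariant Δ S →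
    HasNontrivialU4 S

theorem someShapeMergingEventually_of_crux (h : IndependentStrandsJoin) : SomeShapeMergingEventually := by
  obtain ⟨c, hc, l₁, hl⟩ := independentStrandsJoin_iff_tetraMergingEventually.1 h
  exact ⟨c, hc, tetra, tetra_inj, l₁, fun L hL => by simpa [ShapeMergingAt, U4crit, GGcrit] using hl L hL⟩

theorem someShapeMergingIO_of_eventually (h : SomeShapeMergingEventually) : SomeShapeMergingIO := by
  obtain ⟨c, hc, x, hx, L₁, hL⟩ := h
  exact ⟨c, hc, x, hx, fun L₀ => ⟨max L₀ L₁, le_max_left _ _, hL _ (le_max_right _ _)⟩⟩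

/-- `crux ⟹ W1`. -/
theorem someShapeMergingIO_of_crux (h : IndependentStrandsJoin) : SomeShapeMergingIO :=
  someShapeMergingIO_of_eventually (someShapeMergingEventually_of_crux h)

/-- `W1 ⟹ item 0636` (the landed glue `farMergingGivesU4_proof`). -/
theorem nonGaussianLimit_of_someShapeMergingIO (h : SomeShapeMergingIO) : NonGaussianLimit := by
  obtain ⟨c, hc, x, hx, hio⟩ := h
  exact farMergingGivesU4_proof ⟨c, hc, x, hx, hio⟩

/-- `item 0636 ⟹ W2` (drop the covariance hypothesis). -/
theorem nonGaussianMoebiusLimit_of_nonGaussianLimit (h : NonGaussianLimit) : NonGaussianMoebiusLimit :=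
  fun ρ _ S hρ _ hlim hnd _ => h ρ S hρ hlim hnd

/-- `crux ⟹ W2` (= `JoinForcesU4`, item 14627, landed). -/
theorem nonGaussianMoebiusLimit_of_crux (h : IndependentStrandsJoin) : NonGaussianMoebiusLimit :=
  nonGaussianMoebiusLimit_of_nonGaussianLimit (joinForcesU4_proof h)

/-- **W2 closes the route with the same residual**: `W2 → MoebiusLimit → Ising3DConformalLimit`. -/
theorem closes_of_nonGaussianMoebiusLimit (hW : NonGaussianMoebiusLimit) (hML : MoebiusLimit) :
    _root_.Ising3DConformalLimit := by
  obtain ⟨ρ, Δ, S, hρ, hΔ, hlim, hnd, hmob⟩ := hML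
  exact ⟨ρ, Δ, S, hρ, hΔ, hlim, hnd, hmob, hW ρ Δ S hρ hΔ hlim hnd hmob⟩

/-- **W1 closes the route with the same residual.** -/
theorem closes_of_someShapeMergingIO (hW : SomeShapeMergingIO) (hML : MoebiusLimit) :
    _root_.Ising3DConformalLimit :=
  closes_of_nonGaussianMoebiusLimit
    (nonGaussianMoebiusLimit_of_nonGaussianLimit (nonGaussianLimit_of_someShapeMergingIO hW)) hML

/-- **The ∃-shape dictionary, assembled**: under `LimitExists` (⊂ the residual `MoebiusLimit`),
`W1 ⟺ item 0636` — so W1 is clause (iii) in lattice dress, not a new intermediate. -/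
theorem someShapeMergingEventually_of_nonGaussianLimit (hL : LimitExists) (h : NonGaussianLimit) :
    SomeShapeMergingEventually := by
  obtain ⟨ρ, S, hρ, hlim, hnd⟩ := hL
  obtain ⟨c, hc, a, ha, L₁, hev⟩ := exists_shapeMergingEventually_of_hasNontrivialU4 hlim hnd (h ρ S hρ hlim hnd)
  exact ⟨c, hc, a, ha, L₁, fun L hL => hev L hL⟩

theorem someShapeMergingIO_iff_nonGaussianLimit (hL : LimitExists) : SomeShapeMergingIO ↔ NonGaussianLimit :=
  ⟨nonGaussianLimit_of_someShapeMergingIO,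
    fun h => someShapeMergingIO_of_eventually (someShapeMergingEventually_of_nonGaussianLimit hL h)⟩

theorem limitExists_of_moebiusLimit' (h : MoebiusLimit) : LimitExists := by
  obtain ⟨ρ, Δ, S, hρ, _, hlim, hnd, _⟩ := h
  exact ⟨ρ, S, hρ, hlim, hnd⟩

/-- **The summit gives item 0636 back** (uniqueness of non-degenerate pointwise limits up to scale,
`HasPointwiseScalingLimit.exists_scale_of_isNondegenerateTwoPoint`, and scale-invariance of `U₄ ≢ 0`,
`hasNontrivialU4_iff_of_scale`): so W1/W2/0636 are CONSEQUENCES of the sub-problem statement, i.e. the weakest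
possible replacements of the crux — and each is clause (iii) itself. -/
theorem nonGaussianLimit_of_summit (h : _root_.Ising3DConformalLimit) : NonGaussianLimit := by
  obtain ⟨ρ₀, Δ, S₀, hρ₀, _, hlim₀, hnd₀, _, hU⟩ := h
  intro ρ S hρ hlim hnd
  obtain ⟨c, hc, hscale⟩ :=
    hlim₀.exists_scale_of_isNondegenerateTwoPoint (by norm_num) hρ₀ hρ hlim hnd₀ hnd
  exact (hasNontrivialU4_iff_of_scale hc.ne' hscale).2 hU

theorem nonGaussianMoebiusLimit_of_summit (h : _root_.Ising3DConformalLimit) : NonGaussianMoebiusLimit :=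
  nonGaussianMoebiusLimit_of_nonGaussianLimit (nonGaussianLimit_of_summit h)

theorem someShapeMergingIO_of_summit (h : _root_.Ising3DConformalLimit) : SomeShapeMergingIO := by
  obtain ⟨ρ, Δ, S, hρ, _, hlim, hnd, _, _⟩ := id h
  exact someShapeMergingIO_of_eventually
    (someShapeMergingEventually_of_nonGaussianLimit ⟨ρ, S, hρ, hlim, hnd⟩ (nonGaussianLimit_of_summit h))

/-- Hence, modulo the residual, the three weak forms and item 0636 are all EQUIVALENT TO THE SUB-PROBLEM. -/
theorem summit_iff_nonGaussianLimit (hML : MoebiusLimit) : _root_.Ising3DConformalLimit ↔ NonGaussianLimit :=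
  ⟨nonGaussianLimit_of_summit,
    fun h => closes_of_nonGaussianMoebiusLimit (nonGaussianMoebiusLimit_of_nonGaussianLimit h) hML⟩

/-! ## §S — strengthenings considered -/

/-- **S1.** Uniform-over-shapes far merging (one constant for every injective shape at all its large scales).
Implies the crux (take `x = tetra`); PREDICTED FALSE — pinched shapes: with the pairing `(01|23)` tight and the
pairs far apart, `R₄ → 0` (OPE / `Δ_ε > 2Δ_σ`), so no uniform `c` exists. Too strong. -/
def UniformShapeMerging : Prop :=
  ∃ c : ℝ, 0 < c ∧ ∀ x : Fin 4 → Site 3, Function.Injective x → ∃ L₁ : ℕ, ∀ L : ℕ, L₁ ≤ L → ShapeMergingAt c x L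

theorem crux_of_uniformShapeMerging (h : UniformShapeMerging) : IndependentStrandsJoin := by
  obtain ⟨c, hc, hall⟩ := h
  obtain ⟨L₁, hL⟩ := hall tetra tetra_inj
  exact independentStrandsJoin_iff_tetraMergingEventually.2
    ⟨c, hc, L₁, fun l hl => by simpa [ShapeMergingAt, U4crit, GGcrit] using hL l hl⟩

/-- **S2.** The lead's r7 stub `RectDominance` (quantitative planar floor at the RP-diagonal rectangle):
`∃ c > 0, eventually ⟨σσσσ⟩(l·rect) ≤ (3 - c)·τ_d(l)²`. Implies the crux (landed
`independentStrandsJoin_of_rectDominance`); converse open; it needs `Q(rect) ≤ 3/Wick(rect) ≈ 0.81`, a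
hand-picked threshold (checklist 4c(iv)), not mere non-Gaussianity at the rectangle. -/
def RectDominance : Prop :=
  ∃ c : ℝ, 0 < c ∧ ∃ l₁ : ℕ, ∀ l : ℕ, l₁ ≤ l →
    criticalCorr 3 4 (fun i => (l : ℤ) • (![![-1, -1, -1], ![1, 1, -1], ![-1, -1, 1], ![1, 1, 1]] : Fin 4 → Site 3) i) ≤
      (3 - c) * GGcrit l

theorem crux_of_rectDominance (h : RectDominance) : IndependentStrandsJoin :=
  independentStrandsJoin_of_rectDominance h

/-! ## §D — typed splits considered (assembly proved; NOT filed) -/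

/-- **D1, piece 3: the pure lattice SHAPE TRANSFER** to the regular tetrahedra. -/
def ShapeTransfer : Prop := SomeShapeMergingEventually → TetraMergingEventually

/-- **D1 assembly (kernel-checked):** `LimitExists → NonGaussianLimit (item 0636) → ShapeTransfer → crux`.
Not filed: piece 0636 is clause (iii) of the sub-problem for all limits (the summit's open heart), and piece
`ShapeTransfer` has no plan (abstractly false for Möbius-covariant, Lebowitz-signed four-point structures whose
Ursell function vanishes exactly at the tetrahedral cross-ratio; see census §Negation N2). -/
theorem crux_of_splitD1 (hL : LimitExists) (hNG : NonGaussianLimit) (hT : ShapeTransfer) : IndependentStrandsJoin :=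
  independentStrandsJoin_iff_tetraMergingEventually.2 (hT (someShapeMergingEventually_of_nonGaussianLimit hL hNG))

/-- The three pieces of D1 are each implied by (crux ∧ residual) — i.e. the split loses nothing in truth value. -/
theorem splitD1_of_crux (h : IndependentStrandsJoin) : NonGaussianLimit ∧ ShapeTransfer :=
  ⟨joinForcesU4_proof h, fun _ => independentStrandsJoin_iff_tetraMergingEventually.1 h⟩

/-- **D2 (matched-exponent second moment), as signatures over the loop-O(1) measure of the crux.**
One-point density of the high-temperature source cluster: `ℓ^{xy}_G[z ∈ K_x]`, the `t^{|F|}`-weighted fraction of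
`F ∈ tJoins G univ {x,y}` in which `z` is `F`-reachable from `x`. -/
def htDensity {V : Type*} [Fintype V] [DecidableEq V] (G : SimpleGraph V) [DecidableRel G.Adj] (t : ℝ)
    (x y z : V) : ℝ :=
  (∑ F ∈ tJoins G Set.univ {x, y},
      if (SimpleGraph.fromEdgeSet (↑F : Set (Sym2 V))).Reachable x z then t ^ F.card else 0) /
    loopO1PartitionFunction G t {x, y}

/-- Pair density `ℓ^{xy}_G[z ∈ K_x ∧ z' ∈ K_x]`. -/
def htPairDensity {V : Type*} [Fintype V] [DecidableEq V] (G : SimpleGraph V) [DecidableRel G.Adj] (t : ℝ)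
    (x y z z' : V) : ℝ :=
  (∑ F ∈ tJoins G Set.univ {x, y},
      if (SimpleGraph.fromEdgeSet (↑F : Set (Sym2 V))).Reachable x z ∧
          (SimpleGraph.fromEdgeSet (↑F : Set (Sym2 V))).Reachable x z' then t ^ F.card else 0) /
    loopO1PartitionFunction G t {x, y}

/-- **D2, piece 1 — `StrandOnePointLower D`:** in the critical box, every site of the central ball of radius `l`
lies on the source cluster of the strand `l·a₀ → l·a₁` with density `≥ c·l^{-(3-D)}`. -/
def StrandOnePointLower (D : ℝ) : Prop :=
  ∃ c : ℝ, 0 < c ∧ ∀ l : ℕ, 1 ≤ l → ∃ N₀ : ℕ, ∀ N : ℕ, N₀ ≤ N → ∀ a : Fin 4 → ↥(box 3 N),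
    (∀ i, ((a i : Site 3)) = (l : ℤ) • tetra i) → ∀ z : ↥(box 3 N), (∀ k, |(z : Site 3) k| ≤ (l : ℤ)) →
      c * (l : ℝ) ^ (-(3 - D)) ≤
        htDensity ((zdGraph 3).comap (Subtype.val : ↥(box 3 N) → Site 3)) (Real.tanh (criticalBeta 3)) (a 0) (a 1) z

/-- **D2, piece 2 — `StrandTwoPointUpper D`:** the pair density of the same cluster is at most
`C·l^{-(3-D)}·(1 + |z - z'|)^{-(3-D)}` (quasi-multiplicativity from above, same exponent). -/
def StrandTwoPointUpper (D : ℝ) : Prop :=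
  ∃ C : ℝ, ∀ l : ℕ, 1 ≤ l → ∃ N₀ : ℕ, ∀ N : ℕ, N₀ ≤ N → ∀ a : Fin 4 → ↥(box 3 N),
    (∀ i, ((a i : Site 3)) = (l : ℤ) • tetra i) → ∀ z z' : ↥(box 3 N),
      htPairDensity ((zdGraph 3).comap (Subtype.val : ↥(box 3 N) → Site 3)) (Real.tanh (criticalBeta 3))
          (a 0) (a 1) z z' ≤
        C * (l : ℝ) ^ (-(3 - D)) * (1 + dist ((z : Site 3)) (z' : Site 3)) ^ (-(3 - D))

/-- **D2, piece 3 — the Paley–Zygmund glue** (genuinely provable for `3/2 < D`: `E N ≍ l^{2D-3}`,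
`E N² ≲ l^{4D-6}`; the product structure of the two `tJoins` sums is the landed R1 glue
`stub_secondMomentCurrents` transposed to odd clusters). -/
def SecondMomentGlue (D : ℝ) : Prop :=
  3 / 2 < D → StrandOnePointLower D → StrandTwoPointUpper D → IndependentStrandsJoin

/-- D2 assembly (modus ponens; the content is in the three pieces). Not filed: no `D` makes pieces 1 and 2
simultaneously provable from spin-correlation inputs (`D ≤ 3 - Δ_ε ≈ 1.59` for piece 1 via the ε-minorant,
`D ≥ 2 - η ≈ 1.96` for piece 2 via the double-current tree bound), and at the true `D_HT ≈ 1.73` neither density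
has an expression in spin correlators; R1 (`single-current second moment`) already died on exactly this. -/
theorem crux_of_splitD2 {D : ℝ} (hD : 3 / 2 < D) (h₁ : StrandOnePointLower D) (h₂ : StrandTwoPointUpper D)
    (h₃ : SecondMomentGlue D) : IndependentStrandsJoin :=
  h₃ hD h₁ h₂

end Summit.CriticalPhenomena.Ising3DConformalLimit.Cruxes.IndependentStrandsJoin.S3

end
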